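import Mathlib
import Literature.Barriers.ValiantsHypothesis.CharacteristicTwo
import Literature.Computability.AlgebraicComplexity.AlperBogartVelascoProofs
import Literature.Computability.AlgebraicComplexity.PermanentVsDeterminantProofs
import Literature.Computability.AlgebraicComplexity.MignonRessayreBound
import Literature.Computability.AlgebraicComplexity.GenMatrixPoly
import Literature.Computability.AlgebraicComplexity.DeterminantalComplexityProofs
import Literature.Computability.AlgebraicComplexity.RankOneDeterminantalExpressionsProofs

/-!
# Disproof of `detqp_superquadratic` (stmt-ValiantsHypothesis-0318) — standing adversary file

Crux (decls `UlrichPadded.Superquadratic` = `DetQP.DetqpSuperquadratic`, definitionally equal;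
see NOTE ON IMPORTS — stated here as `SuperquadraticOver ℂ`):

  `∃ ε > 0, ∃ n₀, ∀ n ≥ n₀, (n:ℝ)^(2+ε) ≤ dc(per_n)` over `ℂ`,

`dc` = affine determinantal complexity (`determinantalComplexity`, an attained `sInf`).

## Findings (all theorems below are sorry-free unless marked NEAR-MISS)

* VERDICT so far: RESISTS. `not_superquadratic_iff`: a disproof must exhibit, for EVERY ε > 0,
  infinitely many `n` with `dc(per_n) < n^(2+ε)`, i.e. determinantal representations of the
  permanent of size `n^(2+o(1))` along a subsequence. Nothing below `2^n - 1` (Grenet 2011, in tree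
  `determinantalComplexity_perPoly_le_holds`) is known for any `n ≥ 5`; `dc(per_3) = 7`,
  `9 ≤ dc(per_4) ≤ 15` (Alper–Bogart–Velasco 2017 Cor 1.4 + Grenet, both PROVED in tree). Such an
  upper bound would put the permanent into size-`n^(2+o(1))` determinants infinitely often — of the
  strength of `¬ VNP ⊄ VBP` (i.o. form), i.e. it would all but refute Valiant's hypothesis itself.
* (a) LOAD-BEARING `char ℂ = 0`: `superquadratic_false_without_charZero` — the same statement over
  `ZMod 2` (indeed over every field of characteristic 2) is FALSE, because `per = det` there and
  `dc(per_n) ≤ n < n^(2+ε)`. Any proof must use `char ≠ 2` (barrier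
  `Literature.Barriers.ValiantsHypothesis.PermanentCharTwo`).
* (a) LOAD-BEARING the permanent: `not_superquadratic_detPoly` — for `det_n` the statement is
  false (`dc(det_n) ≤ n`).
* (a) LOAD-BEARING threshold `n₀`: `superquadratic_false_without_threshold` and `threshold_ge_five` —
  for every ε > 0 the inequality `n^(2+ε) ≤ dc(per_n)` FAILS at `n = 2, 3, 4`
  (`dc(per_2) ≤ 3 < 4`, `dc(per_3) = 7 < 9`, `dc(per_4) ≤ 15 < 16`), so every witness has `n₀ ≥ 5`.
  Even the pure square `n² ≤ dc(per_n)` fails for `n ≤ 4` (`not_sq_le_dc_from_three`). Whether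
  `25 ≤ dc(per_5)` holds is OPEN (`13 ≤ dc(per_5) ≤ 31` is all that is known).
* (b) TIGHTNESS of what is known: `exponent_two_holds` — exponent exactly 2 with constant 1/2 holds
  from `n₀ = 3` (Mignon–Ressayre, PROVED in tree); the crux asks for any exponent > 2. The refuter
  note of 2026-08-13 stands: even `(1/2 + δ)·n² ≤ dc(per_n)` eventually is open for every δ > 0.
* (b′) ENGINE EXHAUSTED (checked): `mr_method` — `rank H(f)(x) ≤ 2·dc(f)` for `f(x)=0` (the
  Mignon–Ressayre engine, general form); `mr_method_ceiling_perPoly` — for `per_n` the left side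
  is `≤ n²`; `mr_method_tight` — split quadrics have `rank H = 2k`, `dc ≤ k+1`, so the inequality
  is sharp up to `+2`. Hence NO refinement of the Hessian-rank inequality reaches `n^(2+ε)`.
* (b″) SECOND ENGINE CAPPED (checked): `perPoly_singular_on_two_zero_rows` — `per_n` and all
  first partials vanish on {rows 0,1 = 0} (codim 2n), so ABV17's `dc ≥ codim Sing + 1` gives at
  most `2n + 1`.
* THIRD ENGINE (flattenings / shifted partials): catalogued AND discharged in tree —
  `Literature.Barriers.ValiantsHypothesis.ShiftedPartialsCannotSeparate_holds` (ELSW18 Thm 1.5):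
  no separation of padded `per_m` from `det_n` once `n > 2m² + 2m`; so none of the three engines in
  print can certify `n^(2+ε)`. A proof needs a new invariant; a DISPROOF needs sub-Grenet
  representations for infinitely many `n` — neither exists, hence: resists.
* TEST-BED FOR ANY NEW INVARIANT (consequence of the above; what a prover's candidate must pass):
  it must (i) use `char ≠ 2` (a); (ii) not be a function of Hessian rank at one point (b′: split
  quadrics have full Hessian rank and `dc ≤ #vars/2 + 1`); (iii) not be the codimension of the
  singular locus (b″); (iv) not be a flattening-rank profile — per_n and det_n have IDENTICAL
  profiles (`Literature.Barriers.ValiantsHypothesis.partialDerivativesDetPerm_holds`), and shifted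
  partials fail beyond `2m²+2m` (ELSW); (v) separate `per_n` (dc ≥ n²/2) from `det_n` (dc = n).
* (c) NATURAL STRENGTHENINGS refuted: uniform-in-the-field version (see (a)); `dc(per_n) ≥ edc(per_n) = C(2n,n) − 1` (full-equivariant value, LR17 Thm 2.1) is false for every n ≥ 2 (`dc_lt_full_equivariant_value`);
  `not_eventually_two_pow_le` — "dc(per_n) ≥ 2^n eventually" is false (Grenet); threshold-free
  versions (see (a)). Conversely `superquadratic_of_grenet_optimal`: if Grenet's `2^n - 1` is optimal
  for all large `n` (it is optimal at `n = 3`, and among left-equivariant representations for all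
  `n ≥ 3`, Landsberg–Ressayre 2017 Thm 2.8, in tree `lr_left_equivariant_lower_holds`) the crux holds
  with ε = 1. But FULL symmetry provably costs: `dc_lt_full_equivariant_value` — `dc(per_n) <
  C(2n,n) - 1 = edc(per_n)` (LR17 Thm 2.1) for every `n ≥ 2`.
* (d) TARGETS: none handed over (payload.stuck_stubs = []).
* (f) SERVICE: `superquadratic_iff_natPow` — the crux is equivalent to the cast-free `ℕ` statement
  `∃ k ≥ 1, ∃ n₀, ∀ n ≥ n₀, n^(2k+1) ≤ dc(per_n)^k` (provers need not touch `Real.rpow`).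
* (g) SERVICE: `dc_perPoly_mono` — `dc(per_m) ≤ dc(per_N)` for `m ≤ N` (per_m is a projection of
  per_N); so `9 ≤ dc(per_n)` for all `n ≥ 4` (`nine_le_dc_perPoly`), and a disproof must make
  `log dc(per_n) / log n` dip below `2 + ε` infinitely often along a MONOTONE sequence.
* (e) COMPUTATION (disproof direction, see NOTES.md / kit job ids in comments below): numerical
  search for affine determinantal representations of `per_4` of size `m ≤ 14` over `ℝ`
  (Levenberg–Marquardt / alternating least squares on `det A(p) = per_4(p)` at random points),
  calibrated on `per_3` (`m = 7` must be found, `m = 6` must fail). Status: see `computation_log`.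

Prose lives only in docstrings; every `theorem` here is checked by `lean check`.
-/

set_option linter.dupNamespace false

namespace Summit.ValiantsHypothesis.ValiantsHypothesis.Cruxes.detqp_superquadratic.Disproof

open Literature.Computability.AlgebraicComplexity

/-! ## The crux, parametrised -/

/-- The crux statement over an arbitrary field `k` (the crux itself is the case `k = ℂ`,
`crux_iff`). -/
def SuperquadraticOver (k : Type) [Field k] : Prop :=
  ∃ ε : ℝ, 0 < ε ∧ ∃ n₀ : ℕ, ∀ n ≥ n₀,
    (n : ℝ) ^ (2 + ε) ≤ (determinantalComplexity (perPoly (Fin n) k) : ℝ)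

/-! NOTE ON IMPORTS. This workfile deliberately does NOT import the gate-generated route files
(`Summits…Theses.UlrichPadded` / `…Theses.DetQP`): they are regenerated on every route edit and a
stale farm copy then blocks republication of this file. The crux decls
`UlrichPadded.Superquadratic` and `DetQP.DetqpSuperquadratic` (item stmt-ValiantsHypothesis-0318)
are both LITERALLY (`Iff.rfl`, checked in the refuter's W.lean against the 2026-08-16 route files)
the statement `SuperquadraticOver ℂ` below; every theorem here about `SuperquadraticOver ℂ` is a
theorem about the crux by `rfl`. -/

/-- What a disproof must deliver: for every `ε > 0`, infinitely many `n` with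
`dc(per_n) < n^(2+ε)`. (Pure logic; recorded so that provers and disprovers agree on the
obligation. No such upper bound is known for a single `n ≥ 5` below Grenet's `2^n - 1`.) -/
theorem not_superquadratic_iff :
    ¬ SuperquadraticOver ℂ ↔
      ∀ ε : ℝ, 0 < ε → ∀ n₀ : ℕ, ∃ n ≥ n₀,
        (determinantalComplexity (perPoly (Fin n) ℂ) : ℝ) < (n : ℝ) ^ (2 + ε) := by
  unfold SuperquadraticOver
  push Not
  rfl

/-! ## (a) Load-bearing hypotheses -/

/-- Elementary: for a real base `x > 1` and `ε > 0`, `x^2 < x^(2+ε)`. -/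
theorem sq_lt_rpow_two_add {x ε : ℝ} (hx : 1 < x) (hε : 0 < ε) : x ^ 2 < x ^ (2 + ε) := by
  have h := Real.rpow_lt_rpow_of_exponent_lt hx (show (2 : ℝ) < 2 + ε by linarith)
  rwa [Real.rpow_two] at h

/-- Elementary: for a real base `x > 1` and `ε > 0`, `x < x^(2+ε)`. -/
theorem self_lt_rpow_two_add {x ε : ℝ} (hx : 1 < x) (hε : 0 < ε) : x < x ^ (2 + ε) := by
  have h := Real.rpow_lt_rpow_of_exponent_lt hx (show (1 : ℝ) < 2 + ε by linarith)
  rwa [Real.rpow_one] at h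

/-- In characteristic 2 the crux statement is FALSE: `per_n = det_n`, so `dc(per_n) ≤ n`
(`Literature.Barriers.ValiantsHypothesis.determinantalComplexity_perPoly_le_of_charTwo`), while
`n < n^(2+ε)` for `n ≥ 2`. -/
theorem not_superquadraticOver_of_charTwo (k : Type) [Field k] [CharP k 2] :
    ¬ SuperquadraticOver k := by
  rintro ⟨ε, hε, n₀, h⟩
  have hn := h (n₀ + 2) (Nat.le_add_right n₀ 2)
  have hle : determinantalComplexity (perPoly (Fin (n₀ + 2)) k) ≤ n₀ + 2 :=
    Literature.Barriers.ValiantsHypothesis.determinantalComplexity_perPoly_le_of_charTwo k (n₀ + 2)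
  have hle' : (determinantalComplexity (perPoly (Fin (n₀ + 2)) k) : ℝ) ≤ ((n₀ + 2 : ℕ) : ℝ) := by
    exact_mod_cast hle
  have hx : (1 : ℝ) < ((n₀ + 2 : ℕ) : ℝ) := by
    have : (2 : ℝ) ≤ ((n₀ + 2 : ℕ) : ℝ) := by exact_mod_cast Nat.le_add_left 2 n₀
    linarith
  have hlt := self_lt_rpow_two_add hx hε
  linarith


/-- LOAD-BEARING: the PERMANENT. The same statement for the determinant family is FALSE
(`dc(det_n) ≤ n < n^(2+ε)`, tree lemma `determinantalComplexity_detPoly_le`): whatever proves the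
crux must separate `per_n` from `det_n`. -/
theorem not_superquadratic_detPoly :
    ¬ ∃ ε : ℝ, 0 < ε ∧ ∃ n₀ : ℕ, ∀ n ≥ n₀,
      (n : ℝ) ^ (2 + ε) ≤ (determinantalComplexity (detPoly (Fin n) ℂ) : ℝ) := by
  rintro ⟨ε, hε, n₀, h⟩
  have hn := h (n₀ + 2) (Nat.le_add_right n₀ 2)
  have hle : (determinantalComplexity (detPoly (Fin (n₀ + 2)) ℂ) : ℝ) ≤ ((n₀ + 2 : ℕ) : ℝ) := by
    exact_mod_cast determinantalComplexity_detPoly_le (k := ℂ) (n₀ + 2)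
  have hx : (1 : ℝ) < ((n₀ + 2 : ℕ) : ℝ) := by
    have : (2 : ℝ) ≤ ((n₀ + 2 : ℕ) : ℝ) := by exact_mod_cast Nat.le_add_left 2 n₀
    linarith
  have hlt := self_lt_rpow_two_add hx hε
  linarith

/-- `SuperquadraticWithoutCharZero`: the crux with the field `ℂ` replaced by an ARBITRARY field
(the hypothesis "characteristic 0", implicit in `ℂ`, dropped). -/
def SuperquadraticWithoutCharZero : Prop :=
  ∀ (k : Type) [Field k], SuperquadraticOver k

/-- Any proof of the crux must use `char ℂ ≠ 2`: the field-uniform version fails at `k = ZMod 2`. -/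
theorem superquadratic_false_without_charZero : ¬ SuperquadraticWithoutCharZero :=
  fun h => not_superquadraticOver_of_charTwo (ZMod 2) (h (ZMod 2))

/-- Known small values, all PROVED in tree: `dc(per_3) = 7`, `9 ≤ dc(per_4) ≤ 15`, `dc(per_2) ≤ 3`
(Alper–Bogart–Velasco 2017 Cor 1.4; Grenet 2011). -/
theorem small_values :
    determinantalComplexity (perPoly (Fin 2) ℂ) ≤ 3 ∧
    determinantalComplexity (perPoly (Fin 3) ℂ) = 7 ∧
    9 ≤ determinantalComplexity (perPoly (Fin 4) ℂ) ∧
    determinantalComplexity (perPoly (Fin 4) ℂ) ≤ 15 := by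
  obtain ⟨h3, h4⟩ := alperBogartVelasco2017_cor_1_4_complex alperBogartVelasco2017_cor_1_4_holds
  refine ⟨?_, h3, h4, ?_⟩
  · simpa using determinantalComplexity_perPoly_le_holds ℂ 2 (by norm_num)
  · simpa using determinantalComplexity_perPoly_le_holds ℂ 4 (by norm_num)

/-- The pure square already fails below 5: `n² > dc(per_n)` for `n = 2, 3, 4`. Hence the natural
strengthening "`n² ≤ dc(per_n)` for all `n ≥ 3`" (Mignon–Ressayre without the factor 1/2, from the
same threshold) is FALSE. Whether `25 ≤ dc(per_5)` is open. -/
theorem not_sq_le_dc_from_three :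
    ¬ ∀ n ≥ 3, n ^ 2 ≤ determinantalComplexity (perPoly (Fin n) ℂ) := by
  intro h
  obtain ⟨-, h3, -, -⟩ := small_values
  have := h 3 le_rfl
  omega

/-- LOAD-BEARING threshold: every witness `(ε, n₀)` of the crux has `n₀ ≥ 5`, because
`4^(2+ε) > 16 > 15 ≥ dc(per_4)` (and likewise at `n = 2, 3`). -/
theorem threshold_ge_five {ε : ℝ} (hε : 0 < ε) {n₀ : ℕ}
    (h : ∀ n ≥ n₀, (n : ℝ) ^ (2 + ε) ≤ (determinantalComplexity (perPoly (Fin n) ℂ) : ℝ)) :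
    5 ≤ n₀ := by
  by_contra hlt
  push Not at hlt
  have h4 := h 4 (by omega)
  simp only [Nat.cast_ofNat] at h4
  obtain ⟨-, -, -, hG⟩ := small_values
  have hG' : (determinantalComplexity (perPoly (Fin 4) ℂ) : ℝ) ≤ 15 := by exact_mod_cast hG
  have hpow : (4 : ℝ) ^ 2 < (4 : ℝ) ^ (2 + ε) := sq_lt_rpow_two_add (by norm_num) hε
  norm_num at hpow
  linarith

/-- `SuperquadraticWithoutThreshold`: the crux with `∃ n₀` dropped (the inequality demanded from
`n = 1` on). -/
def SuperquadraticWithoutThreshold : Prop :=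
  ∃ ε : ℝ, 0 < ε ∧ ∀ n : ℕ, 1 ≤ n →
    (n : ℝ) ^ (2 + ε) ≤ (determinantalComplexity (perPoly (Fin n) ℂ) : ℝ)

/-- The threshold is necessary: without it the statement is FALSE (fails at `n = 4`). -/
theorem superquadratic_false_without_threshold : ¬ SuperquadraticWithoutThreshold := by
  rintro ⟨ε, hε, h⟩
  have := threshold_ge_five hε (n₀ := 1) h
  omega

/-! ## (b) Tightness of the known engine -/

/-- The boundary case `ε = 0` (with Mignon–Ressayre's constant 1/2) HOLDS from `n₀ = 3`:
`n²/2 ≤ dc(per_n)` (Mignon–Ressayre 2004 Thm 1.1, PROVED in tree as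
`sq_le_two_mul_determinantalComplexity_perPoly_complex_holds`). The crux asks for exponent `> 2`. -/
theorem exponent_two_holds :
    ∃ n₀ : ℕ, ∀ n ≥ n₀,
      (n : ℝ) ^ (2 : ℝ) / 2 ≤ (determinantalComplexity (perPoly (Fin n) ℂ) : ℝ) := by
  refine ⟨3, fun n hn => ?_⟩
  have h : n ^ 2 ≤ 2 * determinantalComplexity (perPoly (Fin n) ℂ) :=
    sq_le_two_mul_determinantalComplexity_perPoly_complex_holds hn
  have h' : ((n : ℝ)) ^ 2 ≤ 2 * (determinantalComplexity (perPoly (Fin n) ℂ) : ℝ) := by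
    exact_mod_cast h
  rw [Real.rpow_two]
  linarith


/-! ## (b′) The Hessian-rank engine (Mignon–Ressayre) is exhausted at `n²/2`

The only engine behind every unrestricted lower bound in print is: for `f(x) = 0`,
`rank H(f)(x) ≤ 2 · dc(f)` (in tree: `rank_hess0_det_le`). Below: the engine in general form
(`mr_method_origin`, `mr_method`), its CEILING for the permanent (`rank ≤ n²`, so at most
`dc(per_n) ≥ n²/2`), and its TIGHTNESS (`mr_method_tight`: attained up to `+2` by split quadrics,
so the inequality itself cannot be sharpened by more than an additive constant). Any `ε > 0` needs
a different invariant — the planners' "why it might fail", now checked. -/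

section MREngine

open MvPolynomial Matrix

/-- THE ENGINE at the origin: if `f(0) = 0` then `rank H(f)(0) ≤ 2 · dc(f)` (Mignon–Ressayre 2004;
tree lemma `rank_hess0_det_le` applied to an optimal representation, which exists by
`hasDetRepr_determinantalComplexity_holds`). -/
theorem mr_method_origin {σ : Type} [Fintype σ] [DecidableEq σ] (f : MvPolynomial σ ℂ)
    (h0 : constantCoeff f = 0) :
    Matrix.rank (hess0 f) ≤ 2 * determinantalComplexity f := by
  obtain ⟨A, hA, hdet⟩ := hasDetRepr_determinantalComplexity_holds f
  have hrank := rank_hess0_det_le A hA (by rw [hdet, h0])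
  rwa [hdet] at hrank

/-- THE ENGINE at a point of the hypersurface: if `f(x) = 0` then `rank H(f)(x) ≤ 2 · dc(f)`. -/
theorem mr_method {σ : Type} [Fintype σ] [DecidableEq σ] (f : MvPolynomial σ ℂ) (x : σ → ℂ)
    (hx : eval x f = 0) :
    Matrix.rank (hess0 (transl x f)) ≤ 2 * determinantalComplexity f := by
  obtain ⟨A, hA, hdet⟩ := hasDetRepr_determinantalComplexity_holds f
  set A' := (transl x).mapMatrix A with hA'
  have hA'deg : ∀ i j, (A' i j).totalDegree ≤ 1 := fun i j =>
    (totalDegree_transl_le _ _).trans (hA i j)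
  have hA'det : A'.det = transl x f := by rw [hA', ← AlgHom.map_det, hdet]
  have h0 : constantCoeff A'.det = 0 := by rw [hA'det, constantCoeff_transl, hx]
  have hrank := rank_hess0_det_le A' hA'deg h0
  rw [hA'det] at hrank
  exact hrank.trans (Nat.mul_le_mul_left 2 (determinantalComplexity_le_of_hasDetRepr ⟨A, hA, hdet⟩))

/-- CEILING for the permanent: whatever the point `x`, `rank H(per_n)(x) ≤ n²` (an `n² × n²`
matrix), so the engine yields at most `dc(per_n) ≥ n²/2` — never `n^(2+ε)`. -/
theorem mr_method_ceiling_perPoly (n : ℕ) (x : Fin n × Fin n → ℂ) :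
    Matrix.rank (hess0 (transl x (perPoly (Fin n) ℂ)) : Matrix (Fin n × Fin n) (Fin n × Fin n) ℂ)
      ≤ n ^ 2 := by
  have := Matrix.rank_le_card_width
    (hess0 (transl x (perPoly (Fin n) ℂ)) : Matrix (Fin n × Fin n) (Fin n × Fin n) ℂ)
  simpa [Fintype.card_prod, Fintype.card_fin, sq] using this

/-- The split quadric `q_k = ∑ i, x_i y_i` in `2k` variables (tightness witness). -/
noncomputable def splitQuadric (k : ℕ) : MvPolynomial (Fin k ⊕ Fin k) ℂ :=
  ∑ i : Fin k, X (Sum.inl i) * X (Sum.inr i)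

theorem linPart_X {σ : Type*} [DecidableEq σ] (a : σ) :
    linPart (X a : MvPolynomial σ ℂ) = Pi.single a 1 := by
  ext s
  rw [linPart_apply, pderiv_X]
  by_cases h : s = a
  · subst h; simp
  · rw [Pi.single_eq_of_ne' h, Pi.single_eq_of_ne h, map_zero]

/-- `H(q_k)(0)` is the swap permutation matrix. -/
theorem hess0_splitQuadric (k : ℕ) :
    hess0 (splitQuadric k) = (Equiv.sumComm (Fin k) (Fin k)).toPEquiv.toMatrix := by
  ext s t
  simp only [splitQuadric, map_sum, Matrix.sum_apply, hess0_mul, constantCoeff_X, zero_smul,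
    zero_add, Matrix.add_apply, vecMulVec_apply, linPart_X, PEquiv.toMatrix_apply,
    Equiv.toPEquiv_apply, Option.mem_def, Option.some.injEq]
  rcases s with a | a <;> rcases t with b | b <;>
    simp [Pi.single_apply, Finset.sum_ite_eq, eq_comm]

/-- `rank H(q_k)(0) = 2k`. -/
theorem rank_hess0_splitQuadric (k : ℕ) : (hess0 (splitQuadric k)).rank = 2 * k := by
  rw [hess0_splitQuadric]
  have hunit : IsUnit ((Equiv.sumComm (Fin k) (Fin k)).toPEquiv.toMatrix : Matrix _ _ ℂ) := by
    refine IsUnit.of_mul_eq_one ((Equiv.sumComm (Fin k) (Fin k)).toPEquiv.toMatrix) ?_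
    rw [← PEquiv.toMatrix_trans, ← Equiv.toPEquiv_trans]
    rw [show (Equiv.sumComm (Fin k) (Fin k)).trans (Equiv.sumComm (Fin k) (Fin k)) = Equiv.refl _ by
      ext x; simp]
    rw [Equiv.toPEquiv_refl, PEquiv.toMatrix_refl]
  rw [Matrix.rank_of_isUnit _ hunit]
  simp [Fintype.card_sum, two_mul]

/-- `dc(q_k) ≤ k + 1`: `q_k = det [[0, x], [-yᵀ, 1_k]]` (bordered identity, Schur complement). -/
theorem hasDetRepr_splitQuadric (k : ℕ) : HasDetRepr (splitQuadric k) (1 + k) := by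
  classical
  let B : Matrix (Fin 1) (Fin k) (MvPolynomial (Fin k ⊕ Fin k) ℂ) := of fun _ j => X (Sum.inl j)
  let Cm : Matrix (Fin k) (Fin 1) (MvPolynomial (Fin k ⊕ Fin k) ℂ) := of fun i _ => - X (Sum.inr i)
  let M' : Matrix (Fin 1 ⊕ Fin k) (Fin 1 ⊕ Fin k) (MvPolynomial (Fin k ⊕ Fin k) ℂ) :=
    Matrix.fromBlocks 0 B Cm 1
  refine ⟨Matrix.reindex finSumFinEquiv finSumFinEquiv M', ?_, ?_⟩
  · intro i j
    simp only [Matrix.reindex_apply, Matrix.submatrix_apply]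
    rcases finSumFinEquiv.symm i with a | a <;> rcases finSumFinEquiv.symm j with b | b
    · simp [M']
    · simp [M', B, totalDegree_X]
    · simp only [M', Cm, fromBlocks_apply₂₁, of_apply, totalDegree_neg]; simp [totalDegree_X]
    · simp only [M', fromBlocks_apply₂₂, Matrix.one_apply]
      split_ifs <;> simp
  · rw [Matrix.det_reindex_self, Matrix.det_fromBlocks_one₂₂, Matrix.det_unique]
    simp [B, Cm, Matrix.mul_apply, splitQuadric, Matrix.sub_apply]

theorem determinantalComplexity_splitQuadric_le (k : ℕ) :
    determinantalComplexity (splitQuadric k) ≤ k + 1 := by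
  rw [add_comm]
  exact determinantalComplexity_le_of_hasDetRepr (hasDetRepr_splitQuadric k)

/-- TIGHTNESS of the engine: for every `k` there is a polynomial (the split quadric in `2k`
variables) vanishing at `0` with `rank H(0) = 2k` and `dc ≤ k + 1`; so in `rank H ≤ 2·dc` the
right-hand side exceeds the left by at most `2`, uniformly — the inequality cannot be improved
beyond an additive constant, and combined with `mr_method_ceiling_perPoly` the engine is capped at
`dc(per_n) ≥ n²/2`. -/
theorem mr_method_tight (k : ℕ) :
    ∃ q : MvPolynomial (Fin k ⊕ Fin k) ℂ, constantCoeff q = 0 ∧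
      Matrix.rank (hess0 q) = 2 * k ∧ determinantalComplexity q ≤ k + 1 :=
  ⟨splitQuadric k, by simp [splitQuadric], rank_hess0_splitQuadric k,
    determinantalComplexity_splitQuadric_le k⟩

end MREngine


/-! ## (b″) The singular-locus engine (Alper–Bogart–Velasco) is capped at `2n + 1`

ABV17 Thm 1.2: `dc(f) ≥ codim Sing(f) + 1`. For the permanent, `Sing {per_n = 0}` contains the
linear space of matrices with two zero rows (codimension `2n`), so this engine yields at most
`2n + 1 = o(n²)` (ABV17 Rem 1.5). The geometric input, checked: -/

section SingEngine

open MvPolynomial Matrix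

theorem permanent_eq_zero_of_row_eq_zero {ι : Type*} [Fintype ι] [DecidableEq ι] {R : Type*}
    [CommSemiring R] (M : Matrix ι ι R) (i₀ : ι) (h : ∀ j, M i₀ j = 0) : M.permanent = 0 := by
  rw [← Matrix.permanent_transpose]
  exact permanent_eq_zero_of_col_eq_zero _ i₀ fun j => h j

/-- `per_n` and ALL its first partials vanish at every matrix whose rows `0` and `1` are zero:
`Sing {per_n = 0} ⊇` a linear space of codimension `2n`; hence `codim Sing ≤ 2n` and the
singular-locus engine gives at most `dc(per_n) ≥ 2n + 1`. -/
theorem perPoly_singular_on_two_zero_rows {m : ℕ} (x : Fin (m + 2) × Fin (m + 2) → ℂ)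
    (h0 : ∀ j, x (0, j) = 0) (h1 : ∀ j, x (1, j) = 0) :
    eval x (perPoly (Fin (m + 2)) ℂ) = 0 ∧
      ∀ rc : Fin (m + 2) × Fin (m + 2), eval x (pderiv rc (perPoly (Fin (m + 2)) ℂ)) = 0 := by
  refine ⟨?_, ?_⟩
  · rw [eval_perPoly]
    exact permanent_eq_zero_of_row_eq_zero _ 0 fun j => by simpa using h0 j
  · rintro ⟨r, c⟩
    rw [AlperBogartVelasco.eval_pderiv_perPoly_eq_permanent_submatrix]
    by_cases hr : r = 0
    · subst hr
      refine permanent_eq_zero_of_row_eq_zero _ 0 fun j => ?_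
      simp [Fin.succAbove_zero, h1]
    · refine permanent_eq_zero_of_row_eq_zero _ 0 fun j => ?_
      simp [Fin.succAbove_ne_zero_zero hr, h0]

end SingEngine

/-! ## (c) Natural strengthenings -/

/-- "Super-Grenet" is false: `dc(per_n) ≥ 2^n` fails for every `n ≥ 1` (Grenet's `2^n - 1`). -/
theorem not_eventually_two_pow_le :
    ¬ ∃ n₀ : ℕ, ∀ n ≥ n₀, 2 ^ n ≤ determinantalComplexity (perPoly (Fin n) ℂ) := by
  rintro ⟨n₀, h⟩
  have h1 := h (n₀ + 1) (Nat.le_succ n₀)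
  have h2 := determinantalComplexity_perPoly_le_holds ℂ (n₀ + 1) (Nat.succ_pos n₀)
  have : 1 ≤ 2 ^ (n₀ + 1) := Nat.one_le_two_pow
  omega


/-- Arithmetic: `2n < 2^n` for `n ≥ 3`. -/
theorem two_mul_lt_two_pow (n : ℕ) (hn : 3 ≤ n) : 2 * n < 2 ^ n := by
  induction n, hn using Nat.le_induction with
  | base => norm_num
  | succ n hn ih =>
    have : 2 ^ (n + 1) = 2 * 2 ^ n := by ring
    omega

/-- Arithmetic: `2^n < C(2n, n)` for `n ≥ 2`. -/
theorem two_pow_lt_centralBinom (n : ℕ) (hn : 2 ≤ n) : 2 ^ n < Nat.centralBinom n := by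
  rcases Nat.lt_or_ge n 3 with h | h
  · obtain rfl : n = 2 := by omega
    decide
  · have h4 := Nat.four_pow_le_two_mul_self_mul_centralBinom n (by omega)
    have h2n := two_mul_lt_two_pow n h
    by_contra hc
    push Not at hc
    have e4 : (4 : ℕ) ^ n = 2 ^ n * 2 ^ n := by
      rw [← mul_pow]
      norm_num
    have key : 2 * n * 2 ^ n < 4 ^ n := by
      rw [e4]
      exact Nat.mul_lt_mul_of_pos_right h2n (Nat.two_pow_pos n)
    have := Nat.mul_le_mul_left (2 * n) hc
    omega

/-- FULL SYMMETRY COSTS (a checked instance of "equivariant lower bounds do not transfer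
verbatim"): the full-equivariant determinantal complexity of `per_n` is `C(2n,n) - 1`
(Landsberg–Ressayre 2017 Thm 2.1; lower bound in tree: `lr_full_equivariant_lower_holds`), and
this value STRICTLY EXCEEDS `dc(per_n)` for every `n ≥ 2` (Grenet: `dc ≤ 2^n - 1 < C(2n,n) - 1`).
So the natural strengthening "dc(per_n) ≥ edc(per_n) eventually" is false; only the LEFT-
equivariant value `2^n - 1` (LR17 Thm 2.8) is a candidate for `dc` itself
(`superquadratic_of_grenet_optimal`). -/
theorem dc_lt_full_equivariant_value (n : ℕ) (hn : 2 ≤ n) :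
    determinantalComplexity (perPoly (Fin n) ℂ) < Nat.choose (2 * n) n - 1 := by
  have hG := determinantalComplexity_perPoly_le_holds ℂ n (by omega)
  have hC := two_pow_lt_centralBinom n hn
  rw [Nat.centralBinom_eq_two_mul_choose] at hC
  have : 1 ≤ 2 ^ n := Nat.one_le_two_pow
  omega

theorem not_eventually_full_equivariant_value_le :
    ¬ ∃ n₀ : ℕ, ∀ n ≥ n₀, Nat.choose (2 * n) n - 1 ≤ determinantalComplexity (perPoly (Fin n) ℂ) := by
  rintro ⟨n₀, h⟩
  have h1 := h (max n₀ 2) (le_max_left _ _)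
  have h2 := dc_lt_full_equivariant_value (max n₀ 2) (le_max_right _ _)
  omega

/-- Arithmetic: `n³ < 2^n` for `n ≥ 10`. -/
theorem cube_lt_two_pow (n : ℕ) (hn : 10 ≤ n) : n ^ 3 < 2 ^ n := by
  induction n, hn using Nat.le_induction with
  | base => norm_num
  | succ n hn ih =>
    have h1 : 10 * n ^ 2 ≤ n ^ 3 := by
      have := Nat.mul_le_mul_right (n ^ 2) hn
      calc 10 * n ^ 2 ≤ n * n ^ 2 := this
        _ = n ^ 3 := by ring
    have h2 : 10 * n ≤ n ^ 2 := by
      have := Nat.mul_le_mul_right n hn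
      calc 10 * n ≤ n * n := this
        _ = n ^ 2 := by ring
    have h3 : (n + 1) ^ 3 = n ^ 3 + 3 * n ^ 2 + 3 * n + 1 := by ring
    have h4 : 2 ^ (n + 1) = 2 * 2 ^ n := by ring
    rw [h3, h4]
    omega

/-- Upper sandwich: IF Grenet's representation is optimal for all large `n`
(`2^n - 1 ≤ dc(per_n)` eventually — true at `n = 3` by Alper–Bogart–Velasco, and true for all
`n ≥ 3` among left-equivariant representations by Landsberg–Ressayre 2017 Thm 2.8, in tree
`lr_left_equivariant_lower_holds`), THEN the crux holds with `ε = 1`. So the crux is sandwiched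
between a proved exponent-2 statement and the Grenet-optimality conjecture. -/
theorem superquadratic_of_grenet_optimal
    (h : ∃ n₀ : ℕ, ∀ n ≥ n₀, 2 ^ n - 1 ≤ determinantalComplexity (perPoly (Fin n) ℂ)) :
    SuperquadraticOver ℂ := by
  obtain ⟨n₀, h⟩ := h
  refine ⟨1, one_pos, max n₀ 10, fun n hn => ?_⟩
  have hn₀ : n₀ ≤ n := le_trans (le_max_left _ _) hn
  have h10 : 10 ≤ n := le_trans (le_max_right _ _) hn
  have key : n ^ 3 ≤ determinantalComplexity (perPoly (Fin n) ℂ) := by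
    have := cube_lt_two_pow n h10
    have := h n hn₀
    omega
  have key' : ((n : ℝ)) ^ 3 ≤ (determinantalComplexity (perPoly (Fin n) ℂ) : ℝ) := by
    exact_mod_cast key
  have hcast : (n : ℝ) ^ (2 + 1 : ℝ) = (n : ℝ) ^ 3 := by
    rw [show (2 + 1 : ℝ) = ((3 : ℕ) : ℝ) by norm_num, Real.rpow_natCast]
  rw [hcast]
  exact key'


/-! ## (f) Cast-free reformulation (service to provers)

The crux quantifies a real exponent; provers working in `ℕ` may prefer the equivalent form below
(take `ε = 1/k`). -/

/-- `Superquadratic` is equivalent to an `ℕ`-only statement: for some `k ≥ 1`,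
`n^(2k+1) ≤ dc(per_n)^k` for all large `n` (i.e. `ε = 1/k`). -/
theorem superquadratic_iff_natPow :
    SuperquadraticOver ℂ ↔
      ∃ k : ℕ, 0 < k ∧ ∃ n₀ : ℕ, ∀ n ≥ n₀,
        n ^ (2 * k + 1) ≤ determinantalComplexity (perPoly (Fin n) ℂ) ^ k := by
  constructor
  · rintro ⟨ε, hε, n₀, h⟩
    obtain ⟨k, hk⟩ := exists_nat_one_div_lt hε
    refine ⟨k + 1, Nat.succ_pos k, max n₀ 1, fun n hn => ?_⟩
    have hn₀ : n₀ ≤ n := le_trans (le_max_left _ _) hn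
    have hn1 : 1 ≤ n := le_trans (le_max_right _ _) hn
    have h1 : (n : ℝ) ^ (2 + ε) ≤ (determinantalComplexity (perPoly (Fin n) ℂ) : ℝ) := h n hn₀
    have hx1 : (1 : ℝ) ≤ (n : ℝ) := by exact_mod_cast hn1
    have hx0 : (0 : ℝ) ≤ (n : ℝ) := by positivity
    have hKpos : (0 : ℝ) < (k : ℝ) + 1 := by positivity
    have hK : (k : ℝ) + 1 ≠ 0 := hKpos.ne'
    have h2 : (n : ℝ) ^ (2 + 1 / ((k : ℝ) + 1)) ≤ (n : ℝ) ^ (2 + ε) :=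
      Real.rpow_le_rpow_of_exponent_le hx1 (by linarith)
    have h3 := h2.trans h1
    have h4 : ((n : ℝ) ^ (2 + 1 / ((k : ℝ) + 1))) ^ (k + 1) ≤
        (determinantalComplexity (perPoly (Fin n) ℂ) : ℝ) ^ (k + 1) :=
      pow_le_pow_left₀ (by positivity) h3 (k + 1)
    have h5 : ((n : ℝ) ^ (2 + 1 / ((k : ℝ) + 1))) ^ (k + 1) = (n : ℝ) ^ (2 * (k + 1) + 1) := by
      rw [← Real.rpow_natCast, ← Real.rpow_mul hx0]
      have : (2 + 1 / ((k : ℝ) + 1)) * ((k + 1 : ℕ) : ℝ) = ((2 * (k + 1) + 1 : ℕ) : ℝ) := by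
        push_cast
        field_simp
      rw [this, Real.rpow_natCast]
    rw [h5] at h4
    exact_mod_cast h4
  · rintro ⟨k, hk, n₀, h⟩
    have hkpos : (0 : ℝ) < (k : ℝ) := by exact_mod_cast hk
    have hk0 : (k : ℝ) ≠ 0 := hkpos.ne'
    refine ⟨1 / (k : ℝ), one_div_pos.mpr hkpos, n₀, fun n hn => ?_⟩
    have h1 : (n : ℝ) ^ (2 * k + 1) ≤ (determinantalComplexity (perPoly (Fin n) ℂ) : ℝ) ^ k := by
      exact_mod_cast h n hn
    have hx0 : (0 : ℝ) ≤ (n : ℝ) := by positivity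
    have h2 : (n : ℝ) ^ (2 + 1 / (k : ℝ)) = ((n : ℝ) ^ (2 * k + 1)) ^ (1 / (k : ℝ)) := by
      rw [← Real.rpow_natCast, ← Real.rpow_mul hx0]
      congr 1
      push_cast
      field_simp
    have h3 : ((n : ℝ) ^ (2 * k + 1)) ^ (1 / (k : ℝ)) ≤
        ((determinantalComplexity (perPoly (Fin n) ℂ) : ℝ) ^ k) ^ (1 / (k : ℝ)) :=
      Real.rpow_le_rpow (by positivity) h1 (by positivity)
    have h4 : ((determinantalComplexity (perPoly (Fin n) ℂ) : ℝ) ^ k) ^ (1 / (k : ℝ)) =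
        (determinantalComplexity (perPoly (Fin n) ℂ) : ℝ) := by
      rw [← Real.rpow_natCast, ← Real.rpow_mul (by positivity)]
      rw [show ((k : ℕ) : ℝ) * (1 / (k : ℝ)) = 1 by field_simp]
      exact Real.rpow_one _
    rw [h2]
    linarith [h3, h4]


/-! ## (g) Monotonicity of `dc(per_n)` in `n` (service lemma; disproof framing)

`per_m` is a projection of `per_{m+j}` (restrict to block-diagonal matrices with an identity
block), so `dc(per_m) ≤ dc(per_N)` for `m ≤ N`. Consequences recorded: `dc(per_n) ≥ 9` for all
`n ≥ 4`; and the disproof obligation may be read as `liminf log dc(per_n) / log n ≤ 2`. -/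

/-- `dc(per_m) ≤ dc(per_N)` for `m ≤ N` (projection `per_{m+j} → per_m`, tree lemmas
`isProjection_genMatrixPoly_finSum`, `determinantalComplexity_le_of_isProjection_holds`). -/
theorem dc_perPoly_mono {m N : ℕ} (h : m ≤ N) :
    determinantalComplexity (perPoly (Fin m) ℂ) ≤ determinantalComplexity (perPoly (Fin N) ℂ) := by
  obtain ⟨j, rfl⟩ := Nat.exists_eq_add_of_le h
  apply determinantalComplexity_le_of_isProjection_holds
  have hproj := isProjection_genMatrixPoly_finSum (R := ℂ) m j (fun _ => (1 : ℂ)) 1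
  have e1 : (genMatrixPoly fun τ : Equiv.Perm (Fin m) =>
      (fun _ : Equiv.Perm (Fin (m + j)) => (1 : ℂ)) (finSumFinEquiv.permCongr (τ.sumCongr 1))) =
      perPoly (Fin m) ℂ := genMatrixPoly_one
  have e2 : genMatrixPoly (fun _ : Equiv.Perm (Fin (m + j)) => (1 : ℂ)) = perPoly (Fin (m + j)) ℂ :=
    genMatrixPoly_one
  rw [e1, e2] at hproj
  exact hproj

/-- Hence `9 ≤ dc(per_n)` for every `n ≥ 4` and `7 ≤ dc(per_n)` for every `n ≥ 3`
(Alper–Bogart–Velasco + monotonicity). -/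
theorem nine_le_dc_perPoly {n : ℕ} (hn : 4 ≤ n) :
    9 ≤ determinantalComplexity (perPoly (Fin n) ℂ) :=
  (small_values.2.2.1).trans (dc_perPoly_mono hn)

/-! ## (e) Computation log (disproof direction)

`computation_log` is a `True` placeholder whose docstring records the kit jobs; see NOTES.md. -/

/-- COMPUTATION LOG (kit jobs on item stmt-ValiantsHypothesis-0318; scripts in the refuter folder:
`dcsearch/`, `abpsearch2/`, `p44factor/`, `p44v2/`, `p44u/`, `singwit/`). Question probed: is there a
SUB-GRENET affine determinantal representation of `per_4` (size ≤ 14; known `9 ≤ dc(per_4) ≤ 15`)?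
Status 2026-08-16T08:20Z (end of cdisprove cycle 1).

1. Dense Levenberg–Marquardt on `det(A₀ + Σ x_ij B_ij) = per_4` at random points (j004949, size 14,
   D = 3332 unknowns): only local minima (≈9% rms residual). CALIBRATION FAILED: the same method
   does not recover `per_3`'s 7×7 representation (j013230: 0/10) ⇒ dense-LM misses are VOID of
   information. (Cancelled the long runs.)
2. Small ABPs (iterated products of affine/linear matrices; widths `(w₁,…)` ⇒ `dc ≤ 1 + Σwᵢ`),
   ALS + LM on sampled identities (j013219, j015401): `per_3` calibration PASSES (Grenet profile
   (3,3): 3 exact hits / 23; impossible profiles (2,4), (2,2,2): residual floor ≈ 0.3), but at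
   n = 4 the method is UNCALIBRATED — Grenet's own profile (4,6,4) is never found (0/250 Gaussian
   init, 0/188 row-sector init), so the misses on (4,5,4), (4,4,4) and the affine 5-layer profiles
   (all at floor ≈ 0.2) carry no information; the informative n = 4 probe is the exact reduction 3–4.
3. PAPER REDUCTION (NOTES "Research note"): a homogeneous depth-4 ABP for `per_4` has `w₁, w₃ ≥ 4`
   (PROVABLE from the in-tree ABV subspace lemma: `{ℓ=0} ∩ {m=0} ⊂ Sing V(per_4)` has dim ≤ 8), and —
   modulo hypothesis (iii) "the only 8-dim LINEAR subspaces of Sing V(per_4) are {two zero rows},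
   {two zero columns}" — its outer layers are the coordinates of two rows, and the middle width is
   EXACTLY the linear-factorisation rank `w_min` of the 4×4 matrix `P_ab = u_c v_d + u_d v_c` of 2×2
   permanents (`{c,d}` = complement of `{a,b}`) over linear forms in `(u,v) ∈ ℂ⁸`; equivalently
   `w_min = min{rank N : N ∈ ℂ^{32×32}, N + N^τ = H_P}` (Hessian flattening, `τ` = swap of the two
   variable legs). PROVED by hand: "pure" factorisations (α in u only, β in v only) need inner
   dimension ≥ rank of the 16×16 0/1 matrix `[a,b,c,d distinct]` = 6 — Grenet (= Laplace expansion
   along row pairs, width C(4,2) = 6) is optimal among them.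
4. NUMERICS for `w_min` (exact coefficient equations, ALS+LM, j014657/j014961/j014962): w = 6 is found
   from random starts (real 3/324 + 18 near-misses, complex 1/181) and EVERY solution found is pure
   (Grenet type up to GL₆ gauge); w = 5: 0/788 real (residual² floor EXACTLY 4.000 = σ₆² of the pure
   problem, never beaten), 0/357 complex. Verdict: numerically `w_min = 6` ⇒ NO homogeneous (4,5,4)
   ABP ⇒ no size-14 representation of `per_4` OF THIS SHAPE (mod (iii)); exact proof of the mixed
   case OPEN (substitution bounds v = Mu, j015244: degenerate M = I, J admit w = 5, so a proof must
   use a non-degenerate M, e.g. the cyclic shift, where w = 5 was not found in 400 restarts).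
5. HYPOTHESIS (iii), two probes. (a) Witness sampling (j015228, j015281): random complex 8-dim
   affine slices of Sing V(per_4) = {all 3×3 subpermanents vanish} carry ≥ 158–182 distinct points
   each (4000 starts, not yet saturated), tangent dimension 8 at every point (reduced), the LINEAR
   components met are always of zero-rows/zero-columns type (29 detections over 11 slices, never
   exotic) — but Newton sampling is biased against the linear components, so (b) the calibrated
   CHART probe (j015334): W as a graph over a coordinate 8-subset, LM on the exact cubic identities;
   the 12 special charts (supports of two rows/columns) are solved 254/254 times (G' = 0 recovered),
   RANDOM charts 0/505. Verdict: (iii) holds numerically; BY-PRODUCT for the sectional-class-ladder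
   line: the top-dimensional (dim 8) part of Sing V(per_4) = 12 linear components + NONLINEAR
   components of total degree ≥ 179.
6. SUBSTITUTION BOUNDS toward an exact proof of `w_min = 6` (j015244): substituting v = M u, any mixed
   factorisation yields a u-only one of P(u, Mu) (a 16×16 Hessian-flattening problem with 96 free
   parameters, = the commutative Nisan width of yᵀP(u,Mu)z). M = I and M = J are degenerate (inner
   dimension 5 exists); for the cyclic shift, two random real M and the integer matrix
   M₀ = [[-2,-1,-2,0],[-1,2,-2,-1],[-2,-2,-1,-1],[1,1,1,-2]] inner dimension 5 is numerically absent
   (residual² floors 7e-5 / 0.17 / 0.56 / 1.11 over 400 restarts each) while 6 converges. EXACT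
   TARGET for a later cycle: `rank N ≥ 6` for every N with `N + Nᴾ = H_{M₀}` (Gröbner / kernel
   formulation over ℚ) — that alone gives `w_min = 6` rigorously.
* Outcome key unchanged: any certified per_4 representation of size ≤ 14 would be the first
  sub-Grenet permanent representation (it would NOT refute the crux — `threshold_ge_five` only moves
  if dc(per_5) < 25 etc. — but it would kill the Grenet-optimality conjecture behind
  `superquadratic_of_grenet_optimal`); so far every calibrated probe says Grenet is rigid at n = 4. -/
theorem computation_log : True := trivial

end Summit.ValiantsHypothesis.ValiantsHypothesis.Cruxes.detqp_superquadratic.Disproof
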